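import Summits.BirchSwinnertonDyer.BirchSwinnertonDyer.Theorems.SignedLowerHalvesSmallImageLowerHalfBothSignsRttF1CMRealityPrefix
import Literature.NumberTheory.ComplexMultiplication.CMOrderSingularPrimesIndex
import HarnessLib

/-!
# F1 → THE MATCH: the closing's TWO-SIDED CM-reality premise `hψc` from the prefix + `supp d_K ⊆ supp 𝔪` (RULING «SHARP-1», (E2))

Summit `BirchSwinnertonDyer`, crux `SmallImageLowerHalfBothSigns` (stmt-23599), line `rtt_w3` v45 (LEAD `cruxlead-stmt-BirchSwinnertonDyer-23599` g16).
Namespace `…Theorems.SmallImageRttF1Bridge`. THEOREMS ONLY; `--supports stmt-BirchSwinnertonDyer-23599`; closes nothing; BSD is proved for no curve here.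

The S4‴ closing `SmallImageRttReciprocity.junctionRecipValues_of_F1` (p829928) takes the road input
`hψc : ∀ w, ¬ 𝔪 ≤ w.asIdeal → ¬ 𝔪 ≤ (cK • w).asIdeal → ψ (cK • w) = conj (ψ w)`. honda's ★★ `apply_smul_eq_conj_of_prefix` (p829728) proves
`ψ (c • w) = conj (ψ w)` for every `w` over a rational prime `ℓ ∤ d_K·N𝔪` from the crux prefix alone. This file closes the gap between the two
shapes using the sharp producer's export (E2) `hdK : supp d_K ⊆ supp 𝔪`: if neither `w` nor `c • w` divides `𝔪` then the prime `ℓ` below `w`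
divides neither `N𝔪` (a prime `w′ ⊇ 𝔪 + (ℓ)` would be one of `w`, `c • w` — Cauchy in `𝓞_K/𝔪` + Galois transitivity on the fibre) nor `d_K`
(else `(d_K) ⊆ w`, so `𝔪 ≤ w` by (E2)).

* `exists_nat_prime_mem_asIdeal` — a rational prime below every finite place (folklore; adapted from the tree's `Catalan.Minus.exists_nat_prime_mem`).
* ★ `apply_smul_eq_conj_two_sided` — the closing's `hψc`, for every `cK ≠ 1`, from `hK2 σK h𝔪 hψ hψpow` and (E2).

References: [NeukirchANT1999] VII §6 (6.1); [Marcus2018] Ch. 3 Thm. 23, Thm. 25; [Stevenhagen2008NumberRings] §7 (p. 230).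
-/

-- the Theorems namespace of this sub repeats the summit name by design (D-0017 nested layout)
set_option linter.dupNamespace false

noncomputable section

open scoped Classical NumberField ComplexConjugate Pointwise
open NumberField IsDedekindDomain Field

namespace Summit.BirchSwinnertonDyer.BirchSwinnertonDyer.Theorems.SmallImageRttF1Bridge

open Literature.NumberTheory.EllipticCurves Literature.NumberTheory.GaloisRepresentations Literature.NumberTheory.LFunctions

variable {K : Type} [Field K] [NumberField K]

/-- **A rational prime below every finite place**: for `w` a nonzero prime of `𝓞 K` there is a prime number `ℓ` with `(ℓ : 𝓞 K) ∈ w`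
(some prime factor of `N w ∈ w` lies in the prime `w`). [folklore] -/
-- adapted from the tree's `Literature.NumberTheory.DiophantineGeometry.Catalan.Minus.exists_nat_prime_mem` (CatalanMinusPower.lean)
theorem exists_nat_prime_mem_asIdeal (w : HeightOneSpectrum (𝓞 K)) : ∃ ℓ : ℕ, ℓ.Prime ∧ (ℓ : 𝓞 K) ∈ w.asIdeal := by
  have hP : w.asIdeal.IsPrime := w.isPrime
  have hN0 : Ideal.absNorm w.asIdeal ≠ 0 := Ideal.absNorm_eq_zero_iff.not.mpr w.ne_bot
  have hN1 : Ideal.absNorm w.asIdeal ≠ 1 := Ideal.absNorm_eq_one_iff.not.mpr hP.ne_top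
  have hmem : ((Ideal.absNorm w.asIdeal : ℕ) : 𝓞 K) ∈ w.asIdeal := Ideal.absNorm_mem w.asIdeal
  have key : ∀ n : ℕ, 2 ≤ n → (n : 𝓞 K) ∈ w.asIdeal → ∃ ℓ : ℕ, ℓ.Prime ∧ (ℓ : 𝓞 K) ∈ w.asIdeal := by
    intro n
    induction n using Nat.strong_induction_on with
    | _ n ih =>
      intro hn2 hn
      have hmin : n.minFac.Prime := Nat.minFac_prime (by omega)
      obtain ⟨m, hm⟩ := Nat.minFac_dvd n
      have hn' : ((n.minFac * m : ℕ) : 𝓞 K) ∈ w.asIdeal := by rw [← hm]; exact hn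
      rw [Nat.cast_mul] at hn'
      rcases hP.mem_or_mem hn' with h | h
      · exact ⟨_, hmin, h⟩
      · have h2 := hmin.two_le
        have hm1 : m ≠ 1 := by
          rintro rfl
          rw [Nat.cast_one] at h
          exact hP.ne_top ((Ideal.eq_top_iff_one w.asIdeal).mpr h)
        have hm0 : m ≠ 0 := by
          rintro rfl
          rw [mul_zero] at hm
          omega
        have hmn : m < n := by
          have : 2 * m ≤ n := by rw [hm]; exact Nat.mul_le_mul_right m h2
          omega
        exact ih m hmn (by omega) h
  exact key _ (by omega) hmem

/-- **A prime of `𝔪` below `ℓ`**: if `ℓ ∣ N𝔪` (`𝔪 ≠ 0`) there is a finite place `w′ ⊇ 𝔪` with `(ℓ : 𝓞 K) ∈ w′` (a maximal ideal above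
`𝔪 + (ℓ) ≠ (1)`, Cauchy in `𝓞_K/𝔪`). [cite: Stevenhagen2008NumberRings, §7, p. 230] -/
theorem exists_le_asIdeal_natCast_mem_of_dvd_absNorm {𝔪 : Ideal (𝓞 K)} (h𝔪 : 𝔪 ≠ ⊥) {ℓ : ℕ} (hℓ : ℓ.Prime)
    (hdvd : ℓ ∣ Ideal.absNorm 𝔪) : ∃ w' : HeightOneSpectrum (𝓞 K), 𝔪 ≤ w'.asIdeal ∧ (ℓ : 𝓞 K) ∈ w'.asIdeal := by
  have hne := Literature.NumberTheory.ComplexMultiplication.EndOrder.sup_span_natCast_ne_top_of_dvd_absNorm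
    (Ideal.absNorm_eq_zero_iff.not.mpr h𝔪) hℓ hdvd
  obtain ⟨M, hM, hle⟩ := Ideal.exists_le_maximal _ hne
  have hℓM : (ℓ : 𝓞 K) ∈ M := hle (Ideal.mem_sup_right (Ideal.mem_span_singleton_self _))
  have hM0 : M ≠ ⊥ := fun h ↦ by
    rw [h, Ideal.mem_bot] at hℓM
    exact hℓ.ne_zero (by exact_mod_cast hℓM)
  exact ⟨⟨M, hM.isPrime, hM0⟩, le_sup_left.trans hle, hℓM⟩

/-- ★ **The closing's two-sided CM-reality premise `hψc`** (road input (P2) of «ROAD-𝔪») from the crux prefix and the sharp producer's (E2):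
for the Grössencharakter `ψ mod 𝔪` of the imaginary quadratic `K` (`htc` explicit, as in the crux prefix; type `(1,0)` at `σK`, trivial Nebentypus `hψpow`), `supp d_K ⊆ supp 𝔪`, and an
automorphism `c ≠ 1` of `K`: `ψ (c • w) = conj (ψ w)` whenever neither `w` nor `c • w` divides `𝔪`. Proof: the prime `ℓ` below `w` satisfies
`ℓ ∤ d_K·N𝔪` (a prime `w′ ⊇ 𝔪` over `ℓ` is `w` or `c • w`; `ℓ ∣ d_K` would put `(d_K) ⊆ w`), then `apply_smul_eq_conj_of_prefix`.
[cite: NeukirchANT1999, Ch. VII §6 (6.1)] [cite: Marcus2018, Ch. 3 Thm. 25] -/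
theorem apply_smul_eq_conj_two_sided (hK2 : Module.finrank ℚ K = 2) (htc : IsTotallyComplex K) (σK : K →+* ℂ)
    (c : K ≃ₐ[ℚ] K) (hc : c ≠ 1)
    {𝔪 : Ideal (𝓞 K)} (h𝔪 : 𝔪 ≠ ⊥) {ψ : HeightOneSpectrum (𝓞 K) → ℂ} (hψ : IsGrossencharakter 𝔪 (embType σK) (embTypeConj σK) ψ)
    (hψpow : ∀ n : ℕ, Odd n → n.Coprime ((NumberField.discr K).natAbs * Ideal.absNorm 𝔪) →
      idealPow K ψ (Ideal.span {(n : 𝓞 K)}) = (jacobiSym (NumberField.discr K) n : ℂ) * (n : ℂ) ^ (2 - 1))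
    (hdK : ∀ w : HeightOneSpectrum (𝓞 K), ((NumberField.discr K : ℤ) : 𝓞 K) ∈ w.asIdeal → 𝔪 ≤ w.asIdeal)
    {w : HeightOneSpectrum (𝓞 K)} (h1 : ¬ 𝔪 ≤ w.asIdeal) (h2 : ¬ 𝔪 ≤ (c • w).asIdeal) :
    ψ (c • w) = conj (ψ w) := by
  haveI := htc
  obtain ⟨ℓ, hℓ, hℓw⟩ := exists_nat_prime_mem_asIdeal w
  refine apply_smul_eq_conj_of_prefix hK2 σK c hc h𝔪 hψ hψpow hℓ ?_ hℓw
  intro hdvd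
  rcases (Nat.Prime.dvd_mul hℓ).mp hdvd with hd | hN
  · -- `ℓ ∣ |d_K|` ⇒ `(d_K) ⊆ w` ⇒ `𝔪 ≤ w`
    refine h1 (hdK w ?_)
    obtain ⟨k, hk⟩ := Int.ofNat_dvd_left.mpr hd
    rw [hk, Int.cast_mul, Int.cast_natCast]
    exact Ideal.mul_mem_right _ _ hℓw
  · -- `ℓ ∣ N𝔪` ⇒ a prime `w′ ⊇ 𝔪` over `ℓ`, which is `w` or `c • w`
    obtain ⟨w', h𝔪w', hℓw'⟩ := exists_le_asIdeal_natCast_mem_of_dvd_absNorm h𝔪 hℓ hN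
    rcases eq_or_eq_smul_of_natCast_mem hK2 c hc hℓ hℓw hℓw' with h | h
    · exact h1 (h ▸ h𝔪w')
    · exact h2 (h ▸ h𝔪w')

end Summit.BirchSwinnertonDyer.BirchSwinnertonDyer.Theorems.SmallImageRttF1Bridge

end
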